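import Literature.AnabelianGeometry.SemiGraphs.SubgroupPresentationEdgeConjugators
import Literature.AnabelianGeometry.SemiGraphs.ArithPiPresentationOuterCompat
import Literature.AnabelianGeometry.SemiGraphs.ArithTemperedGroupBranchPair
import Literature.AnabelianGeometry.SemiGraphs.TemperedPiPresentationTowerInputs
import Literature.AnabelianGeometry.SemiGraphs.TemperedPiEdgeGroupsInfVerticial
import Literature.AnabelianGeometry.SemiGraphs.TemperedReconstructionR2bProofs
import Literature.AnabelianGeometry.SemiGraphs.TemperedCompactInVerticialAt
import Literature.AnabelianGeometry.SemiGraphs.TemperedEdgeLikeIncomparable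
import Literature.AnabelianGeometry.SemiGraphs.TemperedVerticialNotEdgeLike
import Literature.AnabelianGeometry.SemiGraphs.TemperedEdgeLikeInfOfHosts
import HarnessLib

/-!
# [SemiAnbd] Thm 5.4, producer row T54-B: the EDGE CONJUGATORS `hEc` of `IsArithCompatible` for the
# presentation of `𝔾` in `π₁^temp(𝒢)` and the outer semi-direct product — DISCHARGED from the pair
# transport (BR), and `IsArithCompatible` ASSEMBLED modulo the Def 5.1 (i) chart binders `hV`/`hBR`

Mochizuki, *Semi-graphs of anabelioids*, Publ. RIMS **42** (2006), §5 p. 65 ll. 4–14, Def 5.1 (i)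
p. 62 (with Rmk 2.4.2 p. 26: morphisms of semi-graphs of anabelioids are compatible with the `b_*` up to
conjugation), Thm 3.7 (iii) p. 41, Thm 5.4 p. 66 [cite: MochizukiSemiAnbd2006, Thm 5.4, p. 66].  abc-iut
cell, layer L3, GAP-LEDGER row G-w4d053-1 (T54-B), sub-piece «hEc-inst» (seat abc-iut-w4-d053 gen 3).
PROOF-ONLY (no definition, no named fact).

abc-iut-w4-d082's `isArithCompatible_piPresentation_outerAction_of_thm37` (p427209) assembles the input
`hP : (D.piPresentation h𝒢 T R).IsArithCompatible Φ σ` of the arithmetic tree tower for the outer model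
(`E := π₁^temp(𝒢) ⋊^out_ρ Π_A`, `Φ e := e.1.1`, `σ := baseAct ∘ aug`) modulo `hV`, `hG`, `hEI`, `hEc`;
abc-iut-w4-d085 discharged `hEI` (`piPresentation_hEI`, p428788).  THIS FILE discharges `hEc` — the
edge conjugators WITH THEIR BRANCH CLAUSE — from the branch-granular chart binder `hBR` of
abc-iut-w4-d082's `conj_branchPair_outerAction` (Def 5.1 (i) read on pairs) and Thm 3.7 (iii) at `𝒢`
(`CompactInVerticialAt 𝒢`, already a hypothesis of the Thm 5.4 umbrella):

* `GaloisLevelData.map_conj_s_piPresentation_M` — the POSITIONED BRANCH GROUPS of the presentation ARE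
  the decomposition images of the branch subgroups: `s_b · M_{ε} · s_b⁻¹ = D_{x_w}(Π_b)` for `b : ε → w`
  (levelwise abc-iut-L3-d4's `CovObj.PtData.brAut_conj_eq`, both inclusions);
* `piPresentation_hBR_outerAction` — the PAIR TRANSPORT in presentation currency (the `hBR` input of
  `SubgroupPresentation.exists_edgeConj_of_pairTransport`) from the chart binder `hBR`, via
  `conj_branchPair_outerAction`, `exists_conj_of_isVerticialHom` (Prop 3.2: two verticial homomorphisms
  at one vertex are conjugate) and the identification above;
* `piPresentation_hTwo` / `piPresentation_hNe` — a conjugate vertex group containing `M_ε` is one of the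
  two positioned end groups of `ε` (Thm 3.7 (iii) at `𝒢`: `M_ε` is compact, nontrivial, edge-like), and
  the two end groups are distinct (else `M_ε = s_b⁻¹ H_w s_b` would be verticial AND edge-like);
* **`isArithCompatible_piPresentation_outerAction_of_branchPair`** — `IsArithCompatible` for the
  presentation and the outer model from {`Thm37Hypotheses`, `IsGraph`, `CompactInVerticialAt 𝒢`, `hV`,
  `hBR`} alone (`hself` := d082's `piPresentation_selfNormalizing`, `hedge` := d085's `piPresentation_hEI`,
  vertex conjugators `piPresentation_hVconj_outerAction` from `hV`, and the edge conjugators WITH branch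
  clause — the `hE` input of abc-iut-L3-d4's `IsArithCompatible.of_conj` — by
  `SemiGraph.SubgroupPresentation.exists_edgeConj_of_pairTransport`); its field `exists_isEConj` is `hEc`.

Nothing here takes a side on [IUTchIII] Cor 3.12; typed ≠ proved for Thm 5.4.
-/

namespace Literature.AnabelianGeometry.SemiGraphs

namespace ProfiniteSemiGraph

open CategoryTheory
open Literature.AnabelianGeometry.EtaleTheta

universe u w

variable {𝒢 : ProfiniteSemiGraph.{u}}

/-! ### Transport of edge-group elements along an equality of edges -/

/-- Transport along an equality of edges commutes with inversion. [cite: MochizukiSemiAnbd2006, Def 2.1 p.22] -/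
theorem eqRec_Ge_inv {e₁ e₂ : 𝒢.graph.Edge} (h : e₁ = e₂) (g : 𝒢.Ge e₁) :
    (h ▸ g⁻¹ : 𝒢.Ge e₂) = (h ▸ g : 𝒢.Ge e₂)⁻¹ := by
  subst h; rfl

/-- Transport along an equality of edges is surjective. [cite: MochizukiSemiAnbd2006, Def 2.1 p.22] -/
theorem eqRec_Ge_surjective {e₁ e₂ : 𝒢.graph.Edge} (h : e₁ = e₂) (g' : 𝒢.Ge e₂) :
    ∃ g : 𝒢.Ge e₁, (h ▸ g : 𝒢.Ge e₂) = g' := by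
  subst h; exact ⟨g', rfl⟩

namespace GaloisLevelData

variable (D : GaloisLevelData 𝒢) (h𝒢 : 𝒢.IsCountable)
  (T : ∀ w : 𝒢.graph.Vertex, D.PointSeq h𝒢 w) (R : SemiGraph.RefBranches 𝒢.graph)

/-! ### The positioned branch groups of the presentation are the decomposition images of the `Π_b` -/

/-- **The conjugation identity of the branch elements at `π₁^temp(𝒢)`**: for a branch `b : ε → w` and
`g ∈ Π_ε` (read in `Π_{e(β ε)}`), `s_b · D_{x_ν}(β_*(g)) · s_b⁻¹ = D_{x_w}(b_*(g))` — levelwise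
abc-iut-L3-d4's `CovObj.PtData.brAut_conj_eq`. [cite: MochizukiSemiAnbd2006, Thm 3.7(i) p.40] -/
theorem conj_s_decompHom_brHom (b : 𝒢.graph.Branch) (w : 𝒢.graph.Vertex)
    (hw : 𝒢.graph.abuts b = some w) (g : 𝒢.Ge (𝒢.graph.edgeOf (R.β (𝒢.graph.edgeOf b)))) :
    (D.piPresentation h𝒢 T R).s b *
        (T (R.ν (𝒢.graph.edgeOf b))).decompHom
          (𝒢.brHom (R.β (𝒢.graph.edgeOf b)) (R.ν (𝒢.graph.edgeOf b)) (R.abuts_β _) g) *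
        ((D.piPresentation h𝒢 T R).s b)⁻¹ =
      (T w).decompHom (𝒢.brHom b w hw (R.edgeOf_β (𝒢.graph.edgeOf b) ▸ g)) := by
  have key : (D.piPresentation h𝒢 T R).s b *
        (T (R.ν (𝒢.graph.edgeOf b))).decompHom
          (𝒢.brHom (R.β (𝒢.graph.edgeOf b)) (R.ν (𝒢.graph.edgeOf b)) (R.abuts_β _) g) *
        ((D.piPresentation h𝒢 T R).s b)⁻¹ =
      (T w).decompHom (𝒢.brHom b w hw (R.edgeOf_β (𝒢.graph.edgeOf b) ▸ g⁻¹))⁻¹ := by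
    refine D.pi_ext h𝒢 fun n => ?_
    change D.projAut h𝒢 n _ = D.projAut h𝒢 n _
    simp only [map_mul, map_inv, D.projAut_decompHom h𝒢 T, D.piPresentation_s, D.projAut_brEltPi,
      (D.ptData h𝒢 T R n).brElt_of_abuts (D.cover_sameComponent h𝒢 n) (D.cover_htrans h𝒢 n) b w hw,
      inv_inv]
    rw [← map_inv]
    exact CovObj.PtData.brAut_conj_eq (D.cover_sameComponent h𝒢 n) (D.cover_htrans h𝒢 n)
      (D.ptData h𝒢 T R n) b w hw g
  rw [key, eqRec_Ge_inv]
  simp only [map_inv, inv_inv]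

/-- **The positioned branch group `s_b · M_ε · s_b⁻¹` of the presentation IS the decomposition image
`D_{x_w}(Π_b)` of the branch subgroup**, for every branch `b : ε → w`.
[cite: MochizukiSemiAnbd2006, Thm 3.7(i) p.40] -/
theorem map_conj_s_piPresentation_M (b : 𝒢.graph.Branch) (w : 𝒢.graph.Vertex)
    (hw : 𝒢.graph.abuts b = some w) :
    ((D.piPresentation h𝒢 T R).M (𝒢.graph.edgeOf b)).map
        (MulAut.conj ((D.piPresentation h𝒢 T R).s b)).toMonoidHom =
      (𝒢.branchSubgroup b w hw).map (T w).decompHom := by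
  ext y
  rw [D.piPresentation_M h𝒢 T R]
  constructor
  · rintro ⟨x, ⟨k, ⟨g, rfl⟩, rfl⟩, rfl⟩
    refine ⟨𝒢.brHom b w hw (R.edgeOf_β (𝒢.graph.edgeOf b) ▸ g), ⟨_, rfl⟩, ?_⟩
    exact (D.conj_s_decompHom_brHom h𝒢 T R b w hw g).symm
  · rintro ⟨k', ⟨g', rfl⟩, rfl⟩
    obtain ⟨g, rfl⟩ := eqRec_Ge_surjective (R.edgeOf_β (𝒢.graph.edgeOf b)) g'
    refine ⟨(T (R.ν (𝒢.graph.edgeOf b))).decompHom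
        (𝒢.brHom (R.β (𝒢.graph.edgeOf b)) (R.ν (𝒢.graph.edgeOf b)) (R.abuts_β _) g),
      ⟨_, ⟨g, rfl⟩, rfl⟩, ?_⟩
    exact D.conj_s_decompHom_brHom h𝒢 T R b w hw g

end GaloisLevelData

/-! ### The pair transport (BR) in presentation currency, for the outer semi-direct product -/

section Outer

variable (h36 : 𝒢.Prop36Hypotheses)
  {PA : Type w} [Group PA] (ρ : PA →* TopOut (𝒢.temperedPiChart h36).G)
  (baseAct : PA →* Aut 𝒢.graph)
  (T : ∀ w : 𝒢.graph.Vertex, (𝒢.galoisLevelData h36).PointSeq h36.isCountable w)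
  (R : SemiGraph.RefBranches 𝒢.graph)

/-- Bookkeeping: conjugating the range of a homomorphism. [cite: MochizukiSemiAnbd2006, §5, p. 65] -/
theorem map_conj_range_eq_of_forall {Γ : Type u} [Group Γ] {K : Type u} [Group K]
    (φ ψ : K →* Γ) (g : Γ) (h : ∀ y, g * φ y * g⁻¹ = ψ y) :
    φ.range.map (MulAut.conj g).toMonoidHom = ψ.range := by
  rw [MonoidHom.map_range]
  congr 1
  ext y
  simp [MulAut.conj_apply, h y]

/-- Bookkeeping: conjugating the image of a subgroup under a homomorphism.
[cite: MochizukiSemiAnbd2006, §5, p. 65] -/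
theorem map_conj_map_eq_of_forall {Γ : Type u} [Group Γ] {K : Type u} [Group K]
    (φ ψ : K →* Γ) (g : Γ) (h : ∀ y, g * φ y * g⁻¹ = ψ y) (B : Subgroup K) :
    (B.map φ).map (MulAut.conj g).toMonoidHom = B.map ψ := by
  rw [Subgroup.map_map]
  congr 1
  ext y
  simp [MulAut.conj_apply, h y]

/-- **The pair transport (BR) in presentation currency** for `P := D.piPresentation T R` and the outer
model: for every `e ∈ π₁^temp(𝒢) ⋊^out_ρ Π_A` and every branch `b : ε → w` there is `k` with
`Φ_e(H_w) = k H_{σ_e w} k⁻¹` AND `Φ_e(s_b M_ε s_b⁻¹) = k (s_{σ_e b} M_{σ_e ε} s_{σ_e b}⁻¹) k⁻¹` — from the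
chart binder `hBR` of abc-iut-w4-d082's `conj_branchPair_outerAction` (Def 5.1 (i) on pairs), Prop 3.2
(`exists_conj_of_isVerticialHom`) and `map_conj_s_piPresentation_M`.
[cite: MochizukiSemiAnbd2006, Def 5.1 (i), p. 62] -/
theorem piPresentation_hBR_outerAction
    (hBR : ∀ (a : PA) (b : 𝒢.graph.Branch) (v : 𝒢.graph.Vertex) (hb : 𝒢.graph.abuts b = some v)
      (φ : 𝒢.Gv v →ₜ* (𝒢.temperedPiChart h36).G), IsVerticialHom (𝒢.temperedPiChart h36) v φ →
      ∃ Φ : contMulAut (𝒢.temperedPiChart h36).G, TopOut.mk _ Φ = ρ a ∧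
        ∃ φ' : 𝒢.Gv ((baseAct a).hom.vertexMap v) →ₜ* (𝒢.temperedPiChart h36).G,
          IsVerticialHom (𝒢.temperedPiChart h36) ((baseAct a).hom.vertexMap v) φ' ∧
          ∃ x' : (𝒢.temperedPiChart h36).G,
            Subgroup.map (Φ : MulAut (𝒢.temperedPiChart h36).G).toMonoidHom φ.toMonoidHom.range =
              Subgroup.map (MulAut.conj x').toMonoidHom φ'.toMonoidHom.range ∧
            Subgroup.map (Φ : MulAut (𝒢.temperedPiChart h36).G).toMonoidHom
                (Subgroup.map φ.toMonoidHom (𝒢.branchSubgroup b v hb)) =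
              Subgroup.map (MulAut.conj x').toMonoidHom
                (Subgroup.map φ'.toMonoidHom
                  (𝒢.branchSubgroup ((baseAct a).hom.branchMap b) ((baseAct a).hom.vertexMap v)
                    ((baseAct a).hom.abuts_branchMap b v hb))))
    (e : outerSemidirectProduct ρ) (b : 𝒢.graph.Branch) (w : 𝒢.graph.Vertex)
    (hw : 𝒢.graph.abuts b = some w) :
    ∃ k : (𝒢.temperedPiChart h36).G,
      (((𝒢.galoisLevelData h36).piPresentation h36.isCountable T R).H w).map
          ((((contMulAut (𝒢.temperedPiChart h36).G).subtype.comp (MonoidHom.fst _ _)).comp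
            (outerSemidirectProduct ρ).subtype) e).toMonoidHom =
        (((𝒢.galoisLevelData h36).piPresentation h36.isCountable T R).H
            (((baseAct.comp (outerSemidirectProductSnd ρ)) e).hom.vertexMap w)).map
          (MulAut.conj k).toMonoidHom ∧
      ((((𝒢.galoisLevelData h36).piPresentation h36.isCountable T R).M (𝒢.graph.edgeOf b)).map
            (MulAut.conj (((𝒢.galoisLevelData h36).piPresentation h36.isCountable T R).s b)).toMonoidHom).map
          ((((contMulAut (𝒢.temperedPiChart h36).G).subtype.comp (MonoidHom.fst _ _)).comp
            (outerSemidirectProduct ρ).subtype) e).toMonoidHom =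
        ((((𝒢.galoisLevelData h36).piPresentation h36.isCountable T R).M
              (𝒢.graph.edgeOf (((baseAct.comp (outerSemidirectProductSnd ρ)) e).hom.branchMap b))).map
            (MulAut.conj (((𝒢.galoisLevelData h36).piPresentation h36.isCountable T R).s
              (((baseAct.comp (outerSemidirectProductSnd ρ)) e).hom.branchMap b))).toMonoidHom).map
          (MulAut.conj k).toMonoidHom := by
  have hinj : Function.Injective (toOuterSemidirectProduct ρ) :=
    (outerAction_exact (𝒢.temperedPiChart h36) ρ h36).1
  obtain ⟨φ', hφ', x', h1, h2⟩ := conj_branchPair_outerAction (𝒢.temperedPiChart h36) ρ baseAct hBR e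
    b w hw (T w).decompHomCont (T w).isVerticialHom_decompHomCont 1
  rw [conjSubgroup_map_toOuterSemidirectProduct] at h1 h2
  have h1' := Subgroup.map_injective hinj h1
  have h2' := Subgroup.map_injective hinj h2
  rw [SemiGraph.SubgroupPresentation.map_conj_one'] at h1' h2'
  -- `φ'` is conjugate to the decomposition homomorphism at `w' := (aug e) • w` (Prop 3.2)
  obtain ⟨g, hg⟩ := exists_conj_of_isVerticialHom (𝒢.temperedPiChart h36) φ'
    (T ((baseAct (outerSemidirectProductSnd ρ e)).hom.vertexMap w)).decompHomCont hφ'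
    (T ((baseAct (outerSemidirectProductSnd ρ e)).hom.vertexMap w)).isVerticialHom_decompHomCont
  have hH' : φ'.toMonoidHom.range.map (MulAut.conj g).toMonoidHom =
      ((𝒢.galoisLevelData h36).piPresentation h36.isCountable T R).H
        ((baseAct (outerSemidirectProductSnd ρ e)).hom.vertexMap w) := by
    rw [(𝒢.galoisLevelData h36).piPresentation_H h36.isCountable T R]
    exact map_conj_range_eq_of_forall _ _ g hg
  have hB' : ((𝒢.branchSubgroup ((baseAct (outerSemidirectProductSnd ρ e)).hom.branchMap b)
        ((baseAct (outerSemidirectProductSnd ρ e)).hom.vertexMap w)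
        ((baseAct (outerSemidirectProductSnd ρ e)).hom.abuts_branchMap b w hw)).map φ'.toMonoidHom).map
        (MulAut.conj g).toMonoidHom =
      (((𝒢.galoisLevelData h36).piPresentation h36.isCountable T R).M
          (𝒢.graph.edgeOf ((baseAct (outerSemidirectProductSnd ρ e)).hom.branchMap b))).map
        (MulAut.conj (((𝒢.galoisLevelData h36).piPresentation h36.isCountable T R).s
          ((baseAct (outerSemidirectProductSnd ρ e)).hom.branchMap b))).toMonoidHom := by
    rw [(𝒢.galoisLevelData h36).map_conj_s_piPresentation_M h36.isCountable T R _ _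
      ((baseAct (outerSemidirectProductSnd ρ e)).hom.abuts_branchMap b w hw)]
    exact map_conj_map_eq_of_forall _ _ g hg _
  refine ⟨x' * g⁻¹, ?_, ?_⟩
  · -- vertex groups
    simp only [MonoidHom.comp_apply]
    rw [← hH', SemiGraph.SubgroupPresentation.map_conj_map_conj', inv_mul_cancel_right]
    exact h1'
  · -- positioned branch groups
    simp only [MonoidHom.comp_apply]
    rw [← hB', SemiGraph.SubgroupPresentation.map_conj_map_conj', inv_mul_cancel_right,
      (𝒢.galoisLevelData h36).map_conj_s_piPresentation_M h36.isCountable T R b w hw]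
    exact h2'

end Outer

/-! ### Two hosts and distinct ends, from Thm 3.7 (iii) at `𝒢` -/

section Hosts

variable (h37 : 𝒢.Thm37Hypotheses)
  (T : ∀ w : 𝒢.graph.Vertex,
    (𝒢.galoisLevelData h37.toProp36Hypotheses).PointSeq h37.toProp36Hypotheses.isCountable w)
  (R : SemiGraph.RefBranches 𝒢.graph)

/-- The positioned end group `s_b⁻¹ H_w s_b` of the presentation is a verticial subgroup at `w`.
[cite: MochizukiSemiAnbd2006, Thm 3.7(i) p.40] -/
theorem piPresentation_map_conj_H_mem_verticialSubgroups (w : 𝒢.graph.Vertex)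
    (g : (𝒢.temperedPiChart h37.toProp36Hypotheses).G) :
    (((𝒢.galoisLevelData h37.toProp36Hypotheses).piPresentation h37.toProp36Hypotheses.isCountable
        T R).H w).map (MulAut.conj g).toMonoidHom ∈
      verticialSubgroups (𝒢.temperedPiChart h37.toProp36Hypotheses) w := by
  rw [(𝒢.galoisLevelData h37.toProp36Hypotheses).piPresentation_H h37.toProp36Hypotheses.isCountable T R]
  exact conj_mem_verticialSubgroups _ (T w).range_decompHom_mem_verticialSubgroups g

/-- **Distinct ends `hNe`**: for the two branches `b₁ ≠ b₂` of an edge, abutting to `w₁`, `w₂`, the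
positioned end groups `s_{b₁}⁻¹ H_{w₁} s_{b₁} ≠ s_{b₂}⁻¹ H_{w₂} s_{b₂}` — else, by Thm 3.7 (iv) clause 2
(`piPresentation_hEI`, abc-iut-w4-d085), the edge group `M_ε` would equal a verticial subgroup, which an
edge-like subgroup never is (`not_mem_edgeLikeSubgroups_of_mem_verticialSubgroups`).
[cite: MochizukiSemiAnbd2006, Thm 3.7(iv) p.41] -/
theorem piPresentation_hNe :
    ∀ (b₁ b₂ : 𝒢.graph.Branch) (w₁ w₂ : 𝒢.graph.Vertex), b₁ ≠ b₂ → 𝒢.graph.edgeOf b₁ = 𝒢.graph.edgeOf b₂ →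
      𝒢.graph.abuts b₁ = some w₁ → 𝒢.graph.abuts b₂ = some w₂ →
      (((𝒢.galoisLevelData h37.toProp36Hypotheses).piPresentation h37.toProp36Hypotheses.isCountable
          T R).H w₁).map (MulAut.conj (((𝒢.galoisLevelData h37.toProp36Hypotheses).piPresentation
            h37.toProp36Hypotheses.isCountable T R).s b₁)⁻¹).toMonoidHom ≠
      (((𝒢.galoisLevelData h37.toProp36Hypotheses).piPresentation h37.toProp36Hypotheses.isCountable
          T R).H w₂).map (MulAut.conj (((𝒢.galoisLevelData h37.toProp36Hypotheses).piPresentation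
            h37.toProp36Hypotheses.isCountable T R).s b₂)⁻¹).toMonoidHom := by
  intro b₁ b₂ w₁ w₂ h12 he hw₁ hw₂ hEq
  have hEI := (𝒢.galoisLevelData h37.toProp36Hypotheses).piPresentation_hEI
    h37.toProp36Hypotheses.isCountable T R b₁ b₂ w₁ w₂ h12 he hw₁ hw₂
  -- `M_ε = s_{b₁}⁻¹ H_{w₁} s_{b₁}`
  have hM : ((𝒢.galoisLevelData h37.toProp36Hypotheses).piPresentation
        h37.toProp36Hypotheses.isCountable T R).M (𝒢.graph.edgeOf b₁) =
      (((𝒢.galoisLevelData h37.toProp36Hypotheses).piPresentation h37.toProp36Hypotheses.isCountable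
          T R).H w₁).map (MulAut.conj (((𝒢.galoisLevelData h37.toProp36Hypotheses).piPresentation
            h37.toProp36Hypotheses.isCountable T R).s b₁)⁻¹).toMonoidHom := by
    ext x
    rw [hEI x, mem_map_conj_inv_iff]
    constructor
    · exact fun h => h.1
    · intro h
      refine ⟨h, ?_⟩
      rw [← mem_map_conj_inv_iff, ← hEq, mem_map_conj_inv_iff]
      exact h
  have hMedge := piPresentation_M_mem_edgeLikeSubgroups h37.toProp36Hypotheses T R (𝒢.graph.edgeOf b₁)
  rw [hM] at hMedge
  exact not_mem_edgeLikeSubgroups_of_mem_verticialSubgroups h37 _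
    (piPresentation_map_conj_H_mem_verticialSubgroups h37 T R w₁ _) hMedge

/-- **Two hosts `hTwo`** (Thm 3.7 (iii) at `𝒢`, `CompactInVerticialAt 𝒢`): a conjugate vertex group
`g H_w g⁻¹` containing the edge group `M_ε` (compact, nontrivial, edge-like) is one of the two positioned
end groups `s_{b₁}⁻¹ H_{w₁} s_{b₁}`, `s_{b₂}⁻¹ H_{w₂} s_{b₂}` of `ε`.
[cite: MochizukiSemiAnbd2006, Thm 3.7(iii) p.41] -/
theorem piPresentation_hTwo (hCIV : CompactInVerticialAt 𝒢) :
    ∀ (b₁ b₂ : 𝒢.graph.Branch) (w₁ w₂ : 𝒢.graph.Vertex), b₁ ≠ b₂ → 𝒢.graph.edgeOf b₁ = 𝒢.graph.edgeOf b₂ →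
      𝒢.graph.abuts b₁ = some w₁ → 𝒢.graph.abuts b₂ = some w₂ →
      ∀ (w : 𝒢.graph.Vertex) (g : (𝒢.temperedPiChart h37.toProp36Hypotheses).G),
      ((𝒢.galoisLevelData h37.toProp36Hypotheses).piPresentation h37.toProp36Hypotheses.isCountable
          T R).M (𝒢.graph.edgeOf b₁) ≤
        (((𝒢.galoisLevelData h37.toProp36Hypotheses).piPresentation h37.toProp36Hypotheses.isCountable
          T R).H w).map (MulAut.conj g).toMonoidHom →
      (((𝒢.galoisLevelData h37.toProp36Hypotheses).piPresentation h37.toProp36Hypotheses.isCountable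
          T R).H w).map (MulAut.conj g).toMonoidHom =
        (((𝒢.galoisLevelData h37.toProp36Hypotheses).piPresentation h37.toProp36Hypotheses.isCountable
          T R).H w₁).map (MulAut.conj (((𝒢.galoisLevelData h37.toProp36Hypotheses).piPresentation
            h37.toProp36Hypotheses.isCountable T R).s b₁)⁻¹).toMonoidHom ∨
      (((𝒢.galoisLevelData h37.toProp36Hypotheses).piPresentation h37.toProp36Hypotheses.isCountable
          T R).H w).map (MulAut.conj g).toMonoidHom =
        (((𝒢.galoisLevelData h37.toProp36Hypotheses).piPresentation h37.toProp36Hypotheses.isCountable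
          T R).H w₂).map (MulAut.conj (((𝒢.galoisLevelData h37.toProp36Hypotheses).piPresentation
            h37.toProp36Hypotheses.isCountable T R).s b₂)⁻¹).toMonoidHom := by
  intro b₁ b₂ w₁ w₂ h12 he hw₁ hw₂ w g hle
  have hC := (𝒢.galoisLevelData h37.toProp36Hypotheses).isCompact_piPresentation_M
    h37.toProp36Hypotheses.isCountable T R (𝒢.graph.edgeOf b₁)
  have hMedge := piPresentation_M_mem_edgeLikeSubgroups h37.toProp36Hypotheses T R (𝒢.graph.edgeOf b₁)
  have hne := ne_bot_of_mem_edgeLikeSubgroups verticialInjective_holds h37 _ hMedge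
  obtain ⟨-, h2⟩ := hCIV h37 (𝒢.temperedPiChart h37.toProp36Hypotheses) _ hC
  obtain ⟨huniq, -⟩ := h2 hne w₁ w₂ _ _
    (piPresentation_map_conj_H_mem_verticialSubgroups h37 T R w₁ _)
    (piPresentation_map_conj_H_mem_verticialSubgroups h37 T R w₂ _)
    (piPresentation_hNe h37 T R b₁ b₂ w₁ w₂ h12 he hw₁ hw₂)
    (SemiGraph.SubgroupPresentation.M_le_map_conj_inv_s _ b₁ w₁ hw₁)
    (he ▸ SemiGraph.SubgroupPresentation.M_le_map_conj_inv_s _ b₂ w₂ hw₂)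
  exact huniq w _ (piPresentation_map_conj_H_mem_verticialSubgroups h37 T R w g) hle

end Hosts

/-! ### Assembly: `hEc` and `IsArithCompatible` for the outer model -/

section Assembly

variable (h37 : 𝒢.Thm37Hypotheses)
  {PA : Type w} [Group PA] (ρ : PA →* TopOut (𝒢.temperedPiChart h37.toProp36Hypotheses).G)
  (baseAct : PA →* Aut 𝒢.graph)
  (T : ∀ w : 𝒢.graph.Vertex,
    (𝒢.galoisLevelData h37.toProp36Hypotheses).PointSeq h37.toProp36Hypotheses.isCountable w)
  (R : SemiGraph.RefBranches 𝒢.graph)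

/-- Vertex conjugators in conjugation form for the outer model, from the chart binder `hV`
(abc-iut-w4-d082's `piPresentation_exists_isVConj_outerAction` with `map_eq_of_isVConj`).
[cite: MochizukiSemiAnbd2006, §5, p. 65] -/
theorem piPresentation_hVconj_outerAction
    (hV : ∀ (a : PA) (v : 𝒢.graph.Vertex) (H : Subgroup (𝒢.temperedPiChart h37.toProp36Hypotheses).G),
      H ∈ verticialSubgroups (𝒢.temperedPiChart h37.toProp36Hypotheses) v →
      ∃ φ : contMulAut (𝒢.temperedPiChart h37.toProp36Hypotheses).G, TopOut.mk _ φ = ρ a ∧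
        H.map (φ : MulAut (𝒢.temperedPiChart h37.toProp36Hypotheses).G).toMonoidHom ∈
          verticialSubgroups (𝒢.temperedPiChart h37.toProp36Hypotheses) ((baseAct a).hom.vertexMap v))
    (e : outerSemidirectProduct ρ) (w : 𝒢.graph.Vertex) :
    ∃ k : (𝒢.temperedPiChart h37.toProp36Hypotheses).G,
      (((𝒢.galoisLevelData h37.toProp36Hypotheses).piPresentation h37.toProp36Hypotheses.isCountable
          T R).H w).map
          ((((contMulAut (𝒢.temperedPiChart h37.toProp36Hypotheses).G).subtype.comp
            (MonoidHom.fst _ _)).comp (outerSemidirectProduct ρ).subtype) e).toMonoidHom =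
        (((𝒢.galoisLevelData h37.toProp36Hypotheses).piPresentation h37.toProp36Hypotheses.isCountable
          T R).H (((baseAct.comp (outerSemidirectProductSnd ρ)) e).hom.vertexMap w)).map
          (MulAut.conj k).toMonoidHom := by
  obtain ⟨k, hk⟩ := piPresentation_exists_isVConj_outerAction h37.toProp36Hypotheses ρ baseAct T R hV e w
  exact ⟨k, SemiGraph.SubgroupPresentation.map_eq_of_isVConj _ hk⟩

/-- **`IsArithCompatible` for the presentation of `𝔾` in `π₁^temp(𝒢)` and the outer model
`π₁^temp(𝒢) ⋊^out_ρ Π_A`, ASSEMBLED from the Def 5.1 (i) chart binders `hV`, `hBR` ALONE** (plus the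
print hypotheses `Thm37Hypotheses`, `IsGraph` and Thm 3.7 (iii) at `𝒢`, `CompactInVerticialAt 𝒢`):
`hself` := abc-iut-w4-d082's `piPresentation_selfNormalizing`, `hedge` := abc-iut-w4-d085's
`piPresentation_hEI`, vertex conjugators from `hV`, and the edge conjugators WITH branch clause from this
file. The input `hP` of abc-iut-L3-d4's arithmetic tree tower for the outer model.
[cite: MochizukiSemiAnbd2006, Thm 5.4, p. 66] -/
theorem isArithCompatible_piPresentation_outerAction_of_branchPair (hG : 𝒢.graph.IsGraph)
    (hCIV : CompactInVerticialAt 𝒢)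
    (hV : ∀ (a : PA) (v : 𝒢.graph.Vertex) (H : Subgroup (𝒢.temperedPiChart h37.toProp36Hypotheses).G),
      H ∈ verticialSubgroups (𝒢.temperedPiChart h37.toProp36Hypotheses) v →
      ∃ φ : contMulAut (𝒢.temperedPiChart h37.toProp36Hypotheses).G, TopOut.mk _ φ = ρ a ∧
        H.map (φ : MulAut (𝒢.temperedPiChart h37.toProp36Hypotheses).G).toMonoidHom ∈
          verticialSubgroups (𝒢.temperedPiChart h37.toProp36Hypotheses) ((baseAct a).hom.vertexMap v))
    (hBR : ∀ (a : PA) (b : 𝒢.graph.Branch) (v : 𝒢.graph.Vertex) (hb : 𝒢.graph.abuts b = some v)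
      (φ : 𝒢.Gv v →ₜ* (𝒢.temperedPiChart h37.toProp36Hypotheses).G),
      IsVerticialHom (𝒢.temperedPiChart h37.toProp36Hypotheses) v φ →
      ∃ Φ : contMulAut (𝒢.temperedPiChart h37.toProp36Hypotheses).G, TopOut.mk _ Φ = ρ a ∧
        ∃ φ' : 𝒢.Gv ((baseAct a).hom.vertexMap v) →ₜ* (𝒢.temperedPiChart h37.toProp36Hypotheses).G,
          IsVerticialHom (𝒢.temperedPiChart h37.toProp36Hypotheses) ((baseAct a).hom.vertexMap v) φ' ∧
          ∃ x' : (𝒢.temperedPiChart h37.toProp36Hypotheses).G,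
            Subgroup.map (Φ : MulAut (𝒢.temperedPiChart h37.toProp36Hypotheses).G).toMonoidHom
                φ.toMonoidHom.range =
              Subgroup.map (MulAut.conj x').toMonoidHom φ'.toMonoidHom.range ∧
            Subgroup.map (Φ : MulAut (𝒢.temperedPiChart h37.toProp36Hypotheses).G).toMonoidHom
                (Subgroup.map φ.toMonoidHom (𝒢.branchSubgroup b v hb)) =
              Subgroup.map (MulAut.conj x').toMonoidHom
                (Subgroup.map φ'.toMonoidHom
                  (𝒢.branchSubgroup ((baseAct a).hom.branchMap b) ((baseAct a).hom.vertexMap v)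
                    ((baseAct a).hom.abuts_branchMap b v hb)))) :
    ((𝒢.galoisLevelData h37.toProp36Hypotheses).piPresentation
        h37.toProp36Hypotheses.isCountable T R).IsArithCompatible
      (((contMulAut (𝒢.temperedPiChart h37.toProp36Hypotheses).G).subtype.comp
        (MonoidHom.fst _ _)).comp (outerSemidirectProduct ρ).subtype)
      (baseAct.comp (outerSemidirectProductSnd ρ)) :=
  SemiGraph.SubgroupPresentation.isArithCompatible_of_pairTransport _ _ _
    (piPresentation_selfNormalizing R h37 T) hG.abuts_isSome
    ((𝒢.galoisLevelData h37.toProp36Hypotheses).piPresentation_hEI h37.toProp36Hypotheses.isCountable T R)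
    (piPresentation_hVconj_outerAction h37 ρ baseAct T R hV)
    (piPresentation_hBR_outerAction h37.toProp36Hypotheses ρ baseAct T R hBR)
    (piPresentation_hTwo h37 T R hCIV) (piPresentation_hNe h37 T R)

end Assembly

end ProfiniteSemiGraph

end Literature.AnabelianGeometry.SemiGraphs
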